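import Literature.Analysis.FluidPDE.SuitableWeakExhaustion
import Literature.Analysis.FunctionSpaces.TestFunctionDensity
import HarnessLib

/-!
# Bounded distributional Navier–Stokes solutions are suitable: preliminaries

Analysis/FluidPDE support file (theorem-only) for the discharge of the named fact
`Literature.Analysis.FluidPDE.SereginSverak2009.SuitableOfBounded` (Seregin–Šverák 2009,
Remark 3.4: under the standing assumptions and `v ∈ L_∞(𝒞 × ]-1,-a²[)` for all `a`, the pair
`(v, q)` is a suitable weak solution in `Q`; "it is certainly true in `B × ]-1,-a²[`", loc. cit.
§2, p. 6 of arXiv:0804.1803). The heart of that discharge is the classical fact that an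
essentially bounded distributional solution of the Navier–Stokes system is a suitable weak
solution (Caffarelli–Kohn–Nirenberg 1982, §2; Serrin 1962), proved in the companion files
`NSBoundedSuitableCauchy` (the weak spatial gradient as a strong `L²` limit of mollified
gradients) and `NSBoundedSuitableEnergy` (the local energy inequality). This file collects the
generic tools:

* `exists_open_exhaustion` — a monotone exhaustion of an open subset of a proper normed space by
  open sets with compact closure inside it, swallowing every compact subset (the input of the
  accepted gluing theorem `IsSuitableWeakSolutionOn.of_exhaustion`);
* `exists_energyClass_of_ae_bound` — an a.e. bounded field is in the local energy class
  `L^∞_t L²_x` of `IsSuitableWeakSolutionOn` (Tonelli);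
* `stMollify_sub_kernel`, `norm_stMollify_normed_le` — linearity of the space–time
  mollification in the kernel, and the maximum principle `‖k ⋆ g‖_∞ ≤ ‖g‖_∞` for bump kernels;
* filter-generic versions (index set arbitrary) of the accepted limit lemmas of
  `FluidPDE/MollifiedLimits` (`tendsto_eLpNorm_bilin_sub'`, `tendsto_setIntegral_mul_bilin'`,
  `tendsto_setIntegral_clm_bilin'`), needed along the filter `atTop` of `ℕ × ℕ` (Cauchy
  estimates).

## Mathlib search

Mathlib (this pin) has compact exhaustions of σ-compact spaces (`CompactExhaustion`), but not
the "open sets with compact closure" form with the swallowing property relative to an open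
subset; `Metric.infEDist`, `cthickening`, `ProperSpace` are used to build it directly, as in
the tree's `Literature.Analysis.FunctionSpaces.exists_compact_exhaustion`. Young's inequality
for convolution in the form `‖φ.normed ⋆ g‖_p ≤ ‖g‖_p` is the tree's
`eLpNorm_normed_convolution_le_haar`; the pointwise bound is proved here from
`ContDiffBump.integral_normed`.

## References

* G. Seregin, V. Šverák, *On Type I singularities of the local axi-symmetric solutions of the
  Navier–Stokes equations*, Comm. PDE 34 (2009), arXiv:0804.1803, §2 p. 6 and Remark 3.4.
* L. Caffarelli, R. Kohn, L. Nirenberg, *Partial regularity of suitable weak solutions of the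
  Navier–Stokes equations*, CPAM 35 (1982), §2.
* L. C. Evans, *Partial Differential Equations*, 2nd ed. (2010), App. C.4, Thm. 7.
-/

noncomputable section

open MeasureTheory TopologicalSpace Set Function Filter Topology ContinuousLinearMap Metric
open scoped ENNReal NNReal Convolution

namespace Literature.Analysis.FluidPDE

/-! ### Open exhaustions of open sets -/

section Exhaustion

variable {X : Type*} [NormedAddCommGroup X] [ProperSpace X]

/-- **Open exhaustion of an open set.** Every open subset `Ω` of a proper normed space admits a
monotone sequence of open subsets `U₀ ≤ U₁ ≤ ⋯ ≤ Ω`, each contained in a compact subset of `Ω`,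
such that every compact `K ⊆ Ω` lies in some `Uₙ`: take
`Uₙ = {x : ‖x‖ < n + 1, infEdist(x, Ωᶜ) > 1/(n+1)}`. [folklore] -/
theorem exists_open_exhaustion (Ω : Opens X) :
    ∃ U : ℕ → Opens X, Monotone U ∧
      (∀ n, ∃ K : Set X, IsCompact K ∧ (U n : Set X) ⊆ K ∧ K ⊆ (Ω : Set X)) ∧
      ∀ K ⊆ (Ω : Set X), IsCompact K → ∃ n, K ⊆ (U n : Set X) := by
  set d : X → ℝ≥0∞ := fun x => Metric.infEDist x ((Ω : Set X)ᶜ) with hd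
  have hdc : Continuous d := Metric.continuous_infEDist
  set V : ℕ → Set X := fun n => {x | ((n : ℝ≥0∞) + 1)⁻¹ < d x} ∩ ball (0 : X) (n + 1) with hV
  have hVo : ∀ n, IsOpen (V n) := fun n =>
    (isOpen_lt continuous_const hdc).inter isOpen_ball
  set U : ℕ → Opens X := fun n => ⟨V n, hVo n⟩ with hU
  have hUV : ∀ n, ((U n : Opens X) : Set X) = V n := fun n => rfl
  -- points at positive distance from `Ωᶜ` lie in `Ω`
  have hmemΩ : ∀ x, 0 < d x → x ∈ (Ω : Set X) := fun x hx => by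
    have hx' : x ∉ closure ((Ω : Set X)ᶜ) := (Metric.infEDist_pos_iff_notMem_closure).1 hx
    rw [Ω.isOpen.isClosed_compl.closure_eq] at hx'
    exact not_notMem.1 hx'
  refine ⟨U, fun n m hnm => ?_, fun n => ?_, fun K hKΩ hK => ?_⟩
  · -- monotone
    change V n ⊆ V m
    rintro x ⟨h1, h2⟩
    refine ⟨?_, ball_subset_ball (by exact_mod_cast Nat.succ_le_succ hnm) h2⟩
    change _ < d x at h1
    change _ < d x
    refine lt_of_le_of_lt ?_ h1
    rw [ENNReal.inv_le_inv]
    gcongr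
  · -- compact closure inside `Ω`
    refine ⟨{x | ((n : ℝ≥0∞) + 1)⁻¹ ≤ d x} ∩ closedBall (0 : X) (n + 1), ?_, ?_, ?_⟩
    · exact (isCompact_closedBall (0 : X) (n + 1)).of_isClosed_subset
        ((isClosed_le continuous_const hdc).inter isClosed_closedBall) inter_subset_right
    · rintro x ⟨h1, h2⟩
      change _ < d x at h1
      exact ⟨show _ ≤ d x from h1.le, ball_subset_closedBall h2⟩
    · rintro x ⟨h1, -⟩
      exact hmemΩ x (lt_of_lt_of_le (ENNReal.inv_pos.2 (by simp)) h1)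
  · -- every compact subset of `Ω` is swallowed
    rcases K.eq_empty_or_nonempty with rfl | hKne
    · exact ⟨0, empty_subset _⟩
    obtain ⟨x₀, hx₀K, hx₀⟩ := hK.exists_isMinOn hKne hdc.continuousOn
    have hpos : 0 < d x₀ := by
      have hx' : x₀ ∉ closure ((Ω : Set X)ᶜ) := by
        rw [Ω.isOpen.isClosed_compl.closure_eq]; exact fun h => h (hKΩ hx₀K)
      exact (Metric.infEDist_pos_iff_notMem_closure).2 hx'
    obtain ⟨n₁, hn₁⟩ := ENNReal.exists_inv_nat_lt hpos.ne'
    obtain ⟨r, hr⟩ := hK.isBounded.subset_ball (0 : X)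
    obtain ⟨n₂, hn₂⟩ := exists_nat_gt r
    refine ⟨max n₁ n₂, fun x hx => ⟨?_, ?_⟩⟩
    · have h1 : (((max n₁ n₂ : ℕ) : ℝ≥0∞) + 1)⁻¹ ≤ ((n₁ : ℕ) : ℝ≥0∞)⁻¹ := by
        rw [ENNReal.inv_le_inv]
        calc ((n₁ : ℕ) : ℝ≥0∞) ≤ ((max n₁ n₂ : ℕ) : ℝ≥0∞) := by exact_mod_cast le_max_left _ _
          _ ≤ _ := le_self_add
      exact lt_of_le_of_lt h1 (lt_of_lt_of_le hn₁ (hx₀ hx))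
    · refine ball_subset_ball ?_ (hr hx)
      calc r ≤ (n₂ : ℝ) := hn₂.le
        _ ≤ ((max n₁ n₂ : ℕ) : ℝ) := by exact_mod_cast le_max_right _ _
        _ ≤ _ := by linarith

end Exhaustion

/-! ### The local energy class from an a.e. bound -/

section EnergyClass

variable {E : Type*} [NormedAddCommGroup E] [InnerProductSpace ℝ E] [FiniteDimensional ℝ E]
  [MeasurableSpace E] [BorelSpace E]

/-- **An a.e. bounded field lies in the local energy class `L^∞_t L²_x`.** If `‖u‖ ≤ M` a.e. on a
measurable space–time set `Ω` and `K ⊆ Ω` is compact, then for a.e. `t`,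
`∫ 𝟙_K(t, x) ‖u(t, x)‖² dx ≤ M² |π_x(K)|` (Tonelli / `Measure.ae_ae_of_ae_prod`; the energy clause
(2.1) of Caffarelli–Kohn–Nirenberg 1982 for bounded fields). [folklore] -/
theorem exists_energyClass_of_ae_bound
    {Ω : Set (ℝ × E)} (hΩ : MeasurableSet Ω) {u : ℝ → E → E} {M : ℝ}
    (hM : ∀ᵐ z ∂(volume.restrict Ω), ‖u z.1 z.2‖ ≤ M) {K : Set (ℝ × E)} (hK : IsCompact K)
    (hKΩ : K ⊆ Ω) :
    ∃ C : ℝ≥0, ∀ᵐ t : ℝ, ∫⁻ x, K.indicator (fun z : ℝ × E => ‖u z.1 z.2‖ₑ ^ 2) (t, x) ≤ C := by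
  set B : Set E := Prod.snd '' K with hB
  have hBc : IsCompact B := hK.image continuous_snd
  have hBfin : volume B < ∞ := hBc.measure_lt_top
  have hM' : ∀ᵐ z : ℝ × E, z ∈ Ω → ‖u z.1 z.2‖ ≤ M := (ae_restrict_iff' hΩ).1 hM
  rw [Measure.volume_eq_prod] at hM'
  have hslice : ∀ᵐ t : ℝ, ∀ᵐ x : E, (t, x) ∈ Ω → ‖u t x‖ ≤ M := Measure.ae_ae_of_ae_prod hM'
  refine ⟨(M.toNNReal) ^ 2 * (volume B).toNNReal, ?_⟩
  filter_upwards [hslice] with t ht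
  have hpt : ∀ᵐ x : E, K.indicator (fun z : ℝ × E => ‖u z.1 z.2‖ₑ ^ 2) (t, x) ≤
      B.indicator (fun _ => ((M.toNNReal : ℝ≥0∞)) ^ 2) x := by
    filter_upwards [ht] with x hx
    by_cases hz : (t, x) ∈ K
    · rw [indicator_of_mem hz, indicator_of_mem (show x ∈ B from ⟨(t, x), hz, rfl⟩)]
      have h1 : ‖u t x‖ ≤ M := hx (hKΩ hz)
      have h2 : ‖u t x‖ₑ ≤ (M.toNNReal : ℝ≥0∞) := by
        rw [← ofReal_norm]
        exact ENNReal.ofReal_le_ofReal h1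
      gcongr
    · rw [indicator_of_notMem hz]
      exact bot_le
  calc ∫⁻ x, K.indicator (fun z : ℝ × E => ‖u z.1 z.2‖ₑ ^ 2) (t, x)
      ≤ ∫⁻ x, B.indicator (fun _ => ((M.toNNReal : ℝ≥0∞)) ^ 2) x := lintegral_mono_ae hpt
    _ = ((M.toNNReal : ℝ≥0∞)) ^ 2 * volume B := by
        rw [lintegral_indicator hBc.isClosed.measurableSet, setLIntegral_const]
    _ = (((M.toNNReal) ^ 2 * (volume B).toNNReal : ℝ≥0) : ℝ≥0∞) := by
        rw [ENNReal.coe_mul, ENNReal.coe_pow, ENNReal.coe_toNNReal hBfin.ne]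

end EnergyClass

/-! ### Products of `L^p`-convergent families along an arbitrary filter -/

section LpProducts

variable {X : Type*} [MeasurableSpace X] {μ : Measure X}
variable {E₁ E₂ E₃ : Type*} [NormedAddCommGroup E₁] [NormedSpace ℝ E₁] [NormedAddCommGroup E₂]
  [NormedSpace ℝ E₂] [NormedAddCommGroup E₃] [NormedSpace ℝ E₃]
variable {ι : Type*} {l : Filter ι}

/-- **Products of convergent families converge** (filter-generic form of the accepted
`tendsto_eLpNorm_bilin_sub`): if `Aᵢ → A` in `L^p` and `Bᵢ → B` in `L^q` along a filter `l`, with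
`A ∈ L^p`, `B ∈ L^q`, `1 ≤ q`, `1 ≤ r`, `1/p + 1/q = 1/r`, then `β(Aᵢ, Bᵢ) → β(A, B)` in `L^r`
for every bounded bilinear `β` (Hölder). [folklore] -/
theorem tendsto_eLpNorm_bilin_sub' {p q r : ℝ≥0∞} [ENNReal.HolderTriple p q r] (hq : 1 ≤ q)
    (hr : 1 ≤ r) (β : E₁ →L[ℝ] E₂ →L[ℝ] E₃)
    {A : ι → X → E₁} {A₀ : X → E₁} {B : ι → X → E₂} {B₀ : X → E₂}
    (hAm : ∀ n, AEStronglyMeasurable (A n) μ) (hA₀m : AEStronglyMeasurable A₀ μ)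
    (hBm : ∀ n, AEStronglyMeasurable (B n) μ) (hB₀m : AEStronglyMeasurable B₀ μ)
    (hA₀ : eLpNorm A₀ p μ < ∞) (hB₀ : eLpNorm B₀ q μ < ∞)
    (hA : Tendsto (fun n => eLpNorm (A n - A₀) p μ) l (𝓝 0))
    (hB : Tendsto (fun n => eLpNorm (B n - B₀) q μ) l (𝓝 0)) :
    Tendsto (fun n => eLpNorm (fun x => β (A n x) (B n x) - β (A₀ x) (B₀ x)) r μ) l (𝓝 0) := by
  set M : ℝ≥0∞ := (‖β‖₊ : ℝ≥0∞) with hM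
  -- the bound
  have hbound : ∀ n, eLpNorm (fun x => β (A n x) (B n x) - β (A₀ x) (B₀ x)) r μ ≤
      M * eLpNorm (A n - A₀) p μ * (eLpNorm (B n - B₀) q μ + eLpNorm B₀ q μ) +
        M * eLpNorm A₀ p μ * eLpNorm (B n - B₀) q μ := by
    intro n
    have hsplit : (fun x => β (A n x) (B n x) - β (A₀ x) (B₀ x)) =
        (fun x => β ((A n - A₀) x) (B n x)) + fun x => β (A₀ x) ((B n - B₀) x) := by
      funext x
      simp only [Pi.add_apply, Pi.sub_apply, map_sub, _root_.sub_apply]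
      abel
    rw [hsplit]
    refine (eLpNorm_add_le ?_ ?_ hr).trans (add_le_add ?_ ?_)
    · exact β.continuous₂.comp_aestronglyMeasurable (((hAm n).sub hA₀m).prodMk (hBm n))
    · exact β.continuous₂.comp_aestronglyMeasurable (hA₀m.prodMk ((hBm n).sub hB₀m))
    · refine (eLpNorm_bilin_le (p := p) (q := q) β ((hAm n).sub hA₀m) (hBm n)).trans ?_
      gcongr
      have : B n = (B n - B₀) + B₀ := by funext x; simp
      conv_lhs => rw [this]
      exact eLpNorm_add_le ((hBm n).sub hB₀m) hB₀m hq
    · exact eLpNorm_bilin_le (p := p) (q := q) β hA₀m ((hBm n).sub hB₀m)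
  -- the bound tends to zero
  have hlim : Tendsto (fun n => M * eLpNorm (A n - A₀) p μ * (eLpNorm (B n - B₀) q μ + eLpNorm B₀ q μ) +
      M * eLpNorm A₀ p μ * eLpNorm (B n - B₀) q μ) l (𝓝 0) := by
    have h1 : Tendsto (fun n => M * eLpNorm (A n - A₀) p μ * (eLpNorm (B n - B₀) q μ + eLpNorm B₀ q μ))
        l (𝓝 (M * 0 * (0 + eLpNorm B₀ q μ))) := by
      refine ENNReal.Tendsto.mul (ENNReal.Tendsto.const_mul hA (Or.inr ENNReal.coe_ne_top)) ?_
        (hB.add tendsto_const_nhds) ?_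
      · exact Or.inr (by simpa using hB₀.ne)
      · exact Or.inr (by simp)
    have h2 : Tendsto (fun n => M * eLpNorm A₀ p μ * eLpNorm (B n - B₀) q μ) l
        (𝓝 (M * eLpNorm A₀ p μ * 0)) :=
      ENNReal.Tendsto.const_mul hB (Or.inr (ENNReal.mul_ne_top ENNReal.coe_ne_top hA₀.ne))
    simpa using h1.add h2
  exact tendsto_of_tendsto_of_tendsto_of_le_of_le tendsto_const_nhds hlim (fun n => zero_le)
    hbound

/-- **Weighted set integrals pass to `L¹` limits along a filter** (filter-generic form of the
accepted `tendsto_setIntegral_mul_of_tendsto_eLpNorm_one`). [folklore] -/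
theorem tendsto_setIntegral_mul_of_tendsto_eLpNorm_one' {Φ : ι → X → ℝ} {Φ₀ : X → ℝ} {w : X → ℝ}
    {C : ℝ} (hw : AEStronglyMeasurable w μ) (hwC : ∀ᵐ x ∂μ, ‖w x‖ ≤ C)
    (hΦ : ∀ n, Integrable (Φ n) μ) (hΦ₀ : Integrable Φ₀ μ)
    (h : Tendsto (fun n => eLpNorm (Φ n - Φ₀) 1 μ) l (𝓝 0)) (S : Set X) :
    Tendsto (fun n => ∫ x in S, w x * Φ n x ∂μ) l (𝓝 (∫ x in S, w x * Φ₀ x ∂μ)) := by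
  set C' : ℝ≥0 := C.toNNReal with hC'
  have hwC' : ∀ᵐ x ∂μ, ‖w x‖₊ ≤ C' := by
    filter_upwards [hwC] with x hx
    change ‖w x‖ ≤ (C.toNNReal : ℝ)
    exact hx.trans (Real.le_coe_toNNReal C)
  refine tendsto_integral_of_L1 (μ := μ.restrict S) (fun x => w x * Φ₀ x)
    (hw.mul hΦ₀.1).restrict (Eventually.of_forall fun n =>
      (hΦ n).restrict.bdd_mul hw.restrict (ae_restrict_of_ae hwC)) ?_
  have hb : ∀ n, ∫⁻ x in S, ‖w x * Φ n x - w x * Φ₀ x‖ₑ ∂μ ≤ C' * eLpNorm (Φ n - Φ₀) 1 μ := by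
    intro n
    rw [eLpNorm_one_eq_lintegral_enorm]
    calc ∫⁻ x in S, ‖w x * Φ n x - w x * Φ₀ x‖ₑ ∂μ
        ≤ ∫⁻ x in S, C' * ‖(Φ n - Φ₀) x‖ₑ ∂μ := by
          refine lintegral_mono_ae ((ae_restrict_of_ae hwC').mono fun x hx => ?_)
          rw [← mul_sub, enorm_mul, Pi.sub_apply]
          gcongr
          rw [enorm_eq_nnnorm]
          exact_mod_cast hx
      _ = C' * ∫⁻ x in S, ‖(Φ n - Φ₀) x‖ₑ ∂μ := by
          rw [lintegral_const_mul' _ _ ENNReal.coe_ne_top]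
      _ ≤ C' * ∫⁻ x, ‖(Φ n - Φ₀) x‖ₑ ∂μ := by
          gcongr
          exact Measure.restrict_le_self
  have hlim : Tendsto (fun n => (C' : ℝ≥0∞) * eLpNorm (Φ n - Φ₀) 1 μ) l (𝓝 0) := by
    simpa using ENNReal.Tendsto.const_mul h (Or.inr ENNReal.coe_ne_top)
  exact tendsto_of_tendsto_of_tendsto_of_le_of_le tendsto_const_nhds hlim (fun n => zero_le) hb

/-- **Weighted integrals of bilinear expressions pass to the limit along a filter**
(filter-generic form of the accepted `tendsto_setIntegral_mul_bilin`): if `Aᵢ → A` in `L^p`,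
`Bᵢ → B` in `L^q` (`1 ≤ q`, `1/p + 1/q = 1`), `β` is a bounded bilinear real form and `w` a
bounded weight, then `∫_S w β(Aᵢ, Bᵢ) → ∫_S w β(A, B)`. [folklore] -/
theorem tendsto_setIntegral_mul_bilin' {p q : ℝ≥0∞} [ENNReal.HolderTriple p q 1] (hq : 1 ≤ q)
    (β : E₁ →L[ℝ] E₂ →L[ℝ] ℝ) {A : ι → X → E₁} {A₀ : X → E₁} {B : ι → X → E₂} {B₀ : X → E₂}
    (hA : ∀ n, MemLp (A n) p μ) (hA₀ : MemLp A₀ p μ) (hB : ∀ n, MemLp (B n) q μ)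
    (hB₀ : MemLp B₀ q μ)
    (hAt : Tendsto (fun n => eLpNorm (A n - A₀) p μ) l (𝓝 0))
    (hBt : Tendsto (fun n => eLpNorm (B n - B₀) q μ) l (𝓝 0))
    {w : X → ℝ} {C : ℝ} (hw : AEStronglyMeasurable w μ) (hwC : ∀ᵐ x ∂μ, ‖w x‖ ≤ C) (S : Set X) :
    Tendsto (fun n => ∫ x in S, w x * β (A n x) (B n x) ∂μ) l
      (𝓝 (∫ x in S, w x * β (A₀ x) (B₀ x) ∂μ)) := by
  refine tendsto_setIntegral_mul_of_tendsto_eLpNorm_one' hw hwC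
    (fun n => integrable_bilin_of_memLp β (hA n) (hB n)) (integrable_bilin_of_memLp β hA₀ hB₀)
    ?_ S
  exact tendsto_eLpNorm_bilin_sub' (p := p) (q := q) (r := 1) hq le_rfl β
    (fun n => (hA n).1) hA₀.1 (fun n => (hB n).1) hB₀.1 hA₀.eLpNorm_lt_top hB₀.eLpNorm_lt_top
    hAt hBt

/-- **Functional-weighted set integrals pass to `L¹` limits along a filter** (filter-generic
form of the accepted `tendsto_setIntegral_clm_apply_of_tendsto_eLpNorm_one`). [folklore] -/
theorem tendsto_setIntegral_clm_apply_of_tendsto_eLpNorm_one' {Φ : ι → X → E₃} {Φ₀ : X → E₃}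
    {w : X → E₃ →L[ℝ] ℝ} {C : ℝ} (hw : AEStronglyMeasurable w μ) (hwC : ∀ᵐ x ∂μ, ‖w x‖ ≤ C)
    (hΦ : ∀ n, Integrable (Φ n) μ) (hΦ₀ : Integrable Φ₀ μ)
    (h : Tendsto (fun n => eLpNorm (Φ n - Φ₀) 1 μ) l (𝓝 0)) (S : Set X) :
    Tendsto (fun n => ∫ x in S, w x (Φ n x) ∂μ) l (𝓝 (∫ x in S, w x (Φ₀ x) ∂μ)) := by
  set C' : ℝ≥0 := C.toNNReal with hC'
  have hwC' : ∀ᵐ x ∂μ, ‖w x‖₊ ≤ C' := by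
    filter_upwards [hwC] with x hx
    change ‖w x‖ ≤ (C.toNNReal : ℝ)
    exact hx.trans (Real.le_coe_toNNReal C)
  refine tendsto_integral_of_L1 (μ := μ.restrict S) (fun x => w x (Φ₀ x))
    (integrable_clm_apply_of_bound hw hwC hΦ₀).1.restrict (Eventually.of_forall fun n =>
      (integrable_clm_apply_of_bound hw hwC (hΦ n)).restrict) ?_
  have hb : ∀ n, ∫⁻ x in S, ‖w x (Φ n x) - w x (Φ₀ x)‖ₑ ∂μ ≤ C' * eLpNorm (Φ n - Φ₀) 1 μ := by
    intro n
    rw [eLpNorm_one_eq_lintegral_enorm]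
    calc ∫⁻ x in S, ‖w x (Φ n x) - w x (Φ₀ x)‖ₑ ∂μ
        ≤ ∫⁻ x in S, C' * ‖(Φ n - Φ₀) x‖ₑ ∂μ := by
          refine lintegral_mono_ae ((ae_restrict_of_ae hwC').mono fun x hx => ?_)
          rw [← map_sub, Pi.sub_apply]
          refine (ContinuousLinearMap.le_opENorm _ _).trans ?_
          gcongr
          rw [enorm_eq_nnnorm]
          exact_mod_cast hx
      _ = C' * ∫⁻ x in S, ‖(Φ n - Φ₀) x‖ₑ ∂μ := by
          rw [lintegral_const_mul' _ _ ENNReal.coe_ne_top]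
      _ ≤ C' * ∫⁻ x, ‖(Φ n - Φ₀) x‖ₑ ∂μ := by
          gcongr
          exact Measure.restrict_le_self
  have hlim : Tendsto (fun n => (C' : ℝ≥0∞) * eLpNorm (Φ n - Φ₀) 1 μ) l (𝓝 0) := by
    simpa using ENNReal.Tendsto.const_mul h (Or.inr ENNReal.coe_ne_top)
  exact tendsto_of_tendsto_of_tendsto_of_le_of_le tendsto_const_nhds hlim (fun n => zero_le) hb

/-- **Functional-weighted integrals of bilinear expressions pass to the limit along a filter**
(filter-generic form of the accepted `tendsto_setIntegral_clm_bilin`). [folklore] -/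
theorem tendsto_setIntegral_clm_bilin' {p q : ℝ≥0∞} [ENNReal.HolderTriple p q 1] (hq : 1 ≤ q)
    (β : E₁ →L[ℝ] E₂ →L[ℝ] E₃) {A : ι → X → E₁} {A₀ : X → E₁} {B : ι → X → E₂} {B₀ : X → E₂}
    (hA : ∀ n, MemLp (A n) p μ) (hA₀ : MemLp A₀ p μ) (hB : ∀ n, MemLp (B n) q μ)
    (hB₀ : MemLp B₀ q μ)
    (hAt : Tendsto (fun n => eLpNorm (A n - A₀) p μ) l (𝓝 0))
    (hBt : Tendsto (fun n => eLpNorm (B n - B₀) q μ) l (𝓝 0))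
    {w : X → E₃ →L[ℝ] ℝ} {C : ℝ} (hw : AEStronglyMeasurable w μ) (hwC : ∀ᵐ x ∂μ, ‖w x‖ ≤ C)
    (S : Set X) :
    Tendsto (fun n => ∫ x in S, w x (β (A n x) (B n x)) ∂μ) l
      (𝓝 (∫ x in S, w x (β (A₀ x) (B₀ x)) ∂μ)) := by
  refine tendsto_setIntegral_clm_apply_of_tendsto_eLpNorm_one' hw hwC
    (fun n => memLp_one_iff_integrable.1 (memLp_bilin (r := 1) β (hA n) (hB n)))
    (memLp_one_iff_integrable.1 (memLp_bilin (r := 1) β hA₀ hB₀)) ?_ S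
  exact tendsto_eLpNorm_bilin_sub' (p := p) (q := q) (r := 1) hq le_rfl β
    (fun n => (hA n).1) hA₀.1 (fun n => (hB n).1) hB₀.1 hA₀.eLpNorm_lt_top hB₀.eLpNorm_lt_top
    hAt hBt

omit [NormedSpace ℝ E₁] in
/-- **Differences along two index maps of a convergent family tend to zero**: if
`‖Aᵢ - A₀‖_p → 0` along `l` and `i, j : κ → ι` tend to `l` along `k`, then
`‖A (i c) - A (j c)‖_p → 0` along `k` (triangle inequality; the form used for Cauchy estimates
along `atTop` on `ℕ × ℕ`). [folklore] -/
theorem tendsto_eLpNorm_sub_sub_of_tendsto {p : ℝ≥0∞} (hp : 1 ≤ p) {A : ι → X → E₁} {A₀ : X → E₁}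
    (hAm : ∀ n, AEStronglyMeasurable (A n) μ) (hA₀m : AEStronglyMeasurable A₀ μ)
    (hA : Tendsto (fun n => eLpNorm (A n - A₀) p μ) l (𝓝 0))
    {κ : Type*} {k : Filter κ} {i j : κ → ι} (hi : Tendsto i k l) (hj : Tendsto j k l) :
    Tendsto (fun c => eLpNorm (A (i c) - A (j c) - 0) p μ) k (𝓝 0) := by
  have hb : ∀ c, eLpNorm (A (i c) - A (j c) - 0) p μ ≤
      eLpNorm (A (i c) - A₀) p μ + eLpNorm (A (j c) - A₀) p μ := fun c => by
    rw [sub_zero]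
    have e : A (i c) - A (j c) = (A (i c) - A₀) - (A (j c) - A₀) := by abel
    rw [e]
    exact eLpNorm_sub_le ((hAm _).sub hA₀m) ((hAm _).sub hA₀m) hp
  have hlim : Tendsto (fun c => eLpNorm (A (i c) - A₀) p μ + eLpNorm (A (j c) - A₀) p μ) k (𝓝 0) := by
    simpa using (hA.comp hi).add (hA.comp hj)
  exact tendsto_of_tendsto_of_tendsto_of_le_of_le tendsto_const_nhds hlim (fun c => zero_le) hb

end LpProducts

/-! ### Space–time mollification: linearity in the kernel -/

section Mollify

variable {E : Type*} [NormedAddCommGroup E] [InnerProductSpace ℝ E] [FiniteDimensional ℝ E]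
  [MeasurableSpace E] [BorelSpace E]
variable {F : Type*} [NormedAddCommGroup F] [NormedSpace ℝ F]

/-- **The space–time mollification is linear in the kernel**: for continuous compactly supported
kernels `k₁, k₂` and a locally integrable `g`, `(k₁ - k₂) ⋆ g = k₁ ⋆ g - k₂ ⋆ g` (both
convolution integrals exist; Evans, *PDE*, App. C.4). [folklore] -/
theorem stMollify_sub_kernel {k₁ k₂ : ℝ × E → ℝ} (hk₁ : Continuous k₁) (hk₁c : HasCompactSupport k₁)
    (hk₂ : Continuous k₂) (hk₂c : HasCompactSupport k₂) {g : ℝ × E → F}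
    (hg : LocallyIntegrable g volume) :
    stMollify (k₁ - k₂) g = fun t x => stMollify k₁ g t x - stMollify k₂ g t x := by
  haveI : (volume : Measure (ℝ × E)).IsAddHaarMeasure := Measure.prod.instIsAddHaarMeasure _ _
  funext t x
  simp only [stMollify_apply]
  have h₁ : ConvolutionExistsAt k₁ g (t, x) (lsmul ℝ ℝ) volume :=
    hk₁c.convolutionExists_left _ hk₁ hg _
  have h₂ : ConvolutionExistsAt k₂ g (t, x) (lsmul ℝ ℝ) volume :=
    hk₂c.convolutionExists_left _ hk₂ hg _
  rw [convolution_def, convolution_def, convolution_def, ← integral_sub h₁ h₂]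
  refine integral_congr_ae (Eventually.of_forall fun w => ?_)
  simp only [Pi.sub_apply, map_sub, _root_.sub_apply]

/-- The spatial derivative of a difference of mollifications is the difference of the spatial
derivatives (both mollifications being smooth). [folklore] -/
theorem fderiv_stMollify_sub {k₁ k₂ : ℝ × E → ℝ} (hk₁ : ContDiff ℝ (⊤ : ℕ∞) k₁)
    (hk₁c : HasCompactSupport k₁) (hk₂ : ContDiff ℝ (⊤ : ℕ∞) k₂) (hk₂c : HasCompactSupport k₂)
    {g : ℝ × E → F} (hg : LocallyIntegrable g volume) (t : ℝ) (x : E) :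
    fderiv ℝ (stMollify (k₁ - k₂) g t) x =
      fderiv ℝ (stMollify k₁ g t) x - fderiv ℝ (stMollify k₂ g t) x := by
  haveI : (volume : Measure (ℝ × E)).IsAddHaarMeasure := Measure.prod.instIsAddHaarMeasure _ _
  rw [stMollify_sub_kernel hk₁.continuous hk₁c hk₂.continuous hk₂c hg]
  change fderiv ℝ (fun y => stMollify k₁ g t y - stMollify k₂ g t y) x = _
  have h₁ : DifferentiableAt ℝ (stMollify k₁ g t) x :=
    ((contDiff_stMollify_slice hk₁ hk₁c hg t).differentiable (by simp)).differentiableAt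
  have h₂ : DifferentiableAt ℝ (stMollify k₂ g t) x :=
    ((contDiff_stMollify_slice hk₂ hk₂c hg t).differentiable (by simp)).differentiableAt
  exact fderiv_sub h₁ h₂

end Mollify


end Literature.Analysis.FluidPDE
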